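import Mathlib.RingTheory.Noetherian.Basic
import Mathlib.RingTheory.Ideal.Maps
import Mathlib.Data.Set.Finite.Basic
import Mathlib.Data.Fintype.Pigeonhole
import HarnessLib

/-!
# Closing lemma toolkit (2): the limit round of a walk of loci

Route `FrobeniusClosing`, support item `ClosingLemma` (stmt-ResolutionOfSingularities-16348).

Abstract commutative algebra behind the "limit types" step of the proof of `ClosingLemma`.
A **walk** (written out, no new definitions) consists of prime ideals `P m ⊆ A` (the loci of the
vertices), prime ideals `Q m ⊆ B` (the loci of the edges), two ring maps `ι₁ ι₂ : A →+* B` (the two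
coordinate inclusions) with `ι₁⁻¹(Q m) = P m`, `ι₂⁻¹(Q m) = P (m+1)` (both projections dominant),
and arena labels: `Tpos (j m) ⊆ Q m` (the edge lies on the closed part of piece `j m`) and a
witness `g m ∈ Tneg (j m)` with `g m ∉ Q m` (the edge is not inside the removed hypersurface).

* `exists_stable_subset` — in a Noetherian ring every sequence of ideals has, inside any infinite
  index set, an infinite index set on which the infimum is *stable* (equal to the infimum over every
  infinite subset): a maximal element of the family of such infima.
* `isPrime_biInf_of_stable` — a stable infimum of primes is prime.
* `exists_limit_walk` — if the vertex primes of a walk are pairwise distinct, there is a new walk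
  (same arena data) each of whose vertex primes is STRICTLY contained in some old vertex prime
  (diagonal refinement along the shifted sequences, then stable infima).

OURS; elementary. [folklore]
-/

-- single-problem summit: the doubled namespace component `ResolutionOfSingularities` is forced
set_option linter.dupNamespace false

namespace Summit.ResolutionOfSingularities.ResolutionOfSingularities.Theorems.FrobeniusClosing.ClosingArena

open Set

variable {A : Type*} [CommRing A]

/-- Membership in `⨅ m ∈ M, I m`. [folklore] -/
theorem mem_biInf_iff {I : ℕ → Ideal A} {M : Set ℕ} {x : A} :
    x ∈ ⨅ m ∈ M, I m ↔ ∀ m ∈ M, x ∈ I m := by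
  simp only [Submodule.mem_iInf]

/-! ## Stable infinite index sets -/

/-- In a Noetherian ring, inside every infinite index set `M` there is an infinite `M' ⊆ M` on which
the infimum of the ideals `I m` is **stable**: every infinite `M'' ⊆ M'` has the same infimum.
[folklore] -/
theorem exists_stable_subset [IsNoetherianRing A] (I : ℕ → Ideal A) {M : Set ℕ}
    (hM : M.Infinite) :
    ∃ M' : Set ℕ, M' ⊆ M ∧ M'.Infinite ∧
      ∀ M'' : Set ℕ, M'' ⊆ M' → M''.Infinite → ⨅ m ∈ M'', I m = ⨅ m ∈ M', I m := by
  classical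
  set S : Set (Ideal A) := {J | ∃ M' : Set ℕ, M' ⊆ M ∧ M'.Infinite ∧ J = ⨅ m ∈ M', I m} with hS
  have hne : S.Nonempty := ⟨_, M, Subset.rfl, hM, rfl⟩
  have hnoeth : IsNoetherian A A := inferInstance
  obtain ⟨J, ⟨M', hM'M, hM'inf, rfl⟩, hmax⟩ := (set_has_maximal_iff_noetherian.2 hnoeth) S hne
  refine ⟨M', hM'M, hM'inf, fun M'' hM''M' hM''inf => ?_⟩
  have hle : ⨅ m ∈ M', I m ≤ ⨅ m ∈ M'', I m :=
    le_iInf₂ fun m hm => iInf₂_le m (hM''M' hm)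
  have hmem : (⨅ m ∈ M'', I m) ∈ S := ⟨M'', hM''M'.trans hM'M, hM''inf, rfl⟩
  by_contra hne'
  exact hmax _ hmem (lt_of_le_of_ne hle (Ne.symm hne'))

/-- Stability passes to infinite subsets (with the same infimum). [folklore] -/
theorem stable_mono (I : ℕ → Ideal A) {M M' : Set ℕ}
    (hst : ∀ M'' : Set ℕ, M'' ⊆ M → M''.Infinite → ⨅ m ∈ M'', I m = ⨅ m ∈ M, I m)
    (hM'M : M' ⊆ M) (hM'inf : M'.Infinite) :
    ∀ M'' : Set ℕ, M'' ⊆ M' → M''.Infinite → ⨅ m ∈ M'', I m = ⨅ m ∈ M', I m := by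
  intro M'' hM'' hinf
  rw [hst M'' (hM''.trans hM'M) hinf, hst M' hM'M hM'inf]

/-- **A stable infimum of prime ideals is prime.** [folklore] -/
theorem isPrime_biInf_of_stable (I : ℕ → Ideal A) {M : Set ℕ} (hM : M.Infinite)
    (hprime : ∀ m ∈ M, (I m).IsPrime)
    (hst : ∀ M'' : Set ℕ, M'' ⊆ M → M''.Infinite → ⨅ m ∈ M'', I m = ⨅ m ∈ M, I m) :
    (⨅ m ∈ M, I m).IsPrime := by
  obtain ⟨m₀, hm₀⟩ := hM.nonempty
  refine ⟨?_, ?_⟩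
  · intro htop
    apply (hprime m₀ hm₀).ne_top
    exact eq_top_iff.2 (htop ▸ iInf₂_le m₀ hm₀)
  · intro f g hfg
    have hsplit : M ⊆ {m ∈ M | f ∈ I m} ∪ {m ∈ M | g ∈ I m} := by
      intro m hm
      have h := (mem_biInf_iff.1 hfg) m hm
      rcases (hprime m hm).mem_or_mem h with h | h
      · exact Or.inl ⟨hm, h⟩
      · exact Or.inr ⟨hm, h⟩
    have hinf : ({m ∈ M | f ∈ I m} ∪ {m ∈ M | g ∈ I m}).Infinite := hM.mono hsplit
    rcases Set.infinite_union.1 hinf with h | h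
    · left
      rw [← hst _ (fun m hm => hm.1) h]
      exact mem_biInf_iff.2 fun m hm => hm.2
    · right
      rw [← hst _ (fun m hm => hm.1) h]
      exact mem_biInf_iff.2 fun m hm => hm.2

/-- Pigeonhole: a function into a finite type is constant on an infinite subset of any infinite set.
[folklore] -/
theorem exists_infinite_fibre {β : Type*} [Finite β] (f : ℕ → β) {M : Set ℕ} (hM : M.Infinite) :
    ∃ (b : β) (M' : Set ℕ), M' ⊆ M ∧ M'.Infinite ∧ ∀ m ∈ M', f m = b := by
  classical
  by_contra h
  push Not at h
  have hfin : ∀ b : β, {m ∈ M | f m = b}.Finite := by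
    intro b
    by_contra hinf
    obtain ⟨m, hm, hne⟩ := h b {m ∈ M | f m = b} (fun m hm => hm.1) hinf
    exact hne hm.2
  apply hM
  have : M ⊆ ⋃ b : β, {m ∈ M | f m = b} := fun m hm => Set.mem_iUnion.2 ⟨f m, hm, rfl⟩
  exact (Set.finite_iUnion hfin).subset this

/-! ## The limit round -/

variable {B : Type*} [CommRing B]

/-- One refinement step: inside an infinite `M`, an infinite subset stable for two given sequences
of ideals and on which two given labellings (into finite types) are constant. [folklore] -/
theorem exists_refinement [IsNoetherianRing A] [IsNoetherianRing B] {β γ : Type*} [Finite β]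
    [Finite γ] (I : ℕ → Ideal A) (J : ℕ → Ideal B) (f : ℕ → β) (e : ℕ → γ) {M : Set ℕ}
    (hM : M.Infinite) :
    ∃ M' : Set ℕ, M' ⊆ M ∧ M'.Infinite ∧
      (∀ M'' : Set ℕ, M'' ⊆ M' → M''.Infinite → ⨅ m ∈ M'', I m = ⨅ m ∈ M', I m) ∧
      (∀ M'' : Set ℕ, M'' ⊆ M' → M''.Infinite → ⨅ m ∈ M'', J m = ⨅ m ∈ M', J m) ∧
      (∃ b, ∀ m ∈ M', f m = b) ∧ (∃ c, ∀ m ∈ M', e m = c) := by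
  obtain ⟨M₁, h₁M, h₁inf, h₁st⟩ := exists_stable_subset I hM
  obtain ⟨M₂, h₂M, h₂inf, h₂st⟩ := exists_stable_subset J h₁inf
  obtain ⟨b, M₃, h₃M, h₃inf, h₃⟩ := exists_infinite_fibre f h₂inf
  obtain ⟨c, M₄, h₄M, h₄inf, h₄⟩ := exists_infinite_fibre e h₃inf
  refine ⟨M₄, h₄M.trans (h₃M.trans (h₂M.trans h₁M)), h₄inf, ?_, ?_, ⟨b, fun m hm => h₃ m (h₄M hm)⟩,
    ⟨c, h₄⟩⟩
  · exact stable_mono I h₁st (h₄M.trans (h₃M.trans h₂M)) h₄inf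
  · exact stable_mono J h₂st (h₄M.trans h₃M) h₄inf

/-- **The limit round.** Given a walk whose vertex primes `P m` are pairwise distinct, there is a
walk with the same arena data `(ι₁, ι₂, Tpos, Tneg)` each of whose vertex primes is strictly
contained in some `P n`.  Construction: nested infinite index sets `M 0 ⊇ M 1 ⊇ ⋯`, `M k` stable
for `m ↦ P (m + k)` and `m ↦ Q (m + k - 1)` with the labels of the edges `m + k - 1` constant; then
`P' k = ⨅_{m ∈ M k} P (m + k)` and `Q' k = ⨅_{m ∈ M (k+1)} Q (m + k)`. [folklore] -/
theorem exists_limit_walk [IsNoetherianRing A] [IsNoetherianRing B] (ι₁ ι₂ : A →+* B) {k : ℕ}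
    (Tpos : Fin k → Set B) (Tneg : Fin k → Finset B) (P : ℕ → Ideal A) (Q : ℕ → Ideal B)
    (j : ℕ → Fin k) (g : ℕ → B) (hP : ∀ m, (P m).IsPrime) (hQ : ∀ m, (Q m).IsPrime)
    (h1 : ∀ m f, ι₁ f ∈ Q m ↔ f ∈ P m) (h2 : ∀ m f, ι₂ f ∈ Q m ↔ f ∈ P (m + 1))
    (h3 : ∀ m, Tpos (j m) ⊆ Q m) (h4 : ∀ m, g m ∈ Tneg (j m) ∧ g m ∉ Q m)
    (hinj : Function.Injective P) :
    ∃ (P' : ℕ → Ideal A) (Q' : ℕ → Ideal B) (j' : ℕ → Fin k) (g' : ℕ → B),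
      (∀ m, (P' m).IsPrime) ∧ (∀ m, (Q' m).IsPrime) ∧
      (∀ m f, ι₁ f ∈ Q' m ↔ f ∈ P' m) ∧ (∀ m f, ι₂ f ∈ Q' m ↔ f ∈ P' (m + 1)) ∧
      (∀ m, Tpos (j' m) ⊆ Q' m) ∧ (∀ m, g' m ∈ Tneg (j' m) ∧ g' m ∉ Q' m) ∧
      (∀ m, ∃ n, P' m < P n) := by
  classical
  -- the `g`-labels as a map into a finite type
  let G : ℕ → ↥(Finset.univ.biUnion Tneg) := fun m =>
    ⟨g m, Finset.mem_biUnion.2 ⟨j m, Finset.mem_univ _, (h4 m).1⟩⟩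
  -- the refinement step at level `l`: stable for `P (· + l)` and `Q (· + (l - 1))`, labels of the
  -- edges `· + (l - 1)` constant (at `l = 0` the `Q`/label part is not used)
  have step : ∀ (l : ℕ) (M : Set ℕ), M.Infinite → ∃ M' : Set ℕ, M' ⊆ M ∧ M'.Infinite ∧
      (∀ M'' : Set ℕ, M'' ⊆ M' → M''.Infinite →
        ⨅ m ∈ M'', P (m + l) = ⨅ m ∈ M', P (m + l)) ∧
      (∀ M'' : Set ℕ, M'' ⊆ M' → M''.Infinite →
        ⨅ m ∈ M'', Q (m + (l - 1)) = ⨅ m ∈ M', Q (m + (l - 1))) ∧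
      (∃ b, ∀ m ∈ M', j (m + (l - 1)) = b) ∧ (∃ c, ∀ m ∈ M', G (m + (l - 1)) = c) :=
    fun l M hM => exists_refinement (fun m => P (m + l)) (fun m => Q (m + (l - 1)))
      (fun m => j (m + (l - 1))) (fun m => G (m + (l - 1))) hM
  choose R hRsub hRinf hRP hRQ hRj hRG using step
  -- the nested infinite index sets `M 0 ⊇ M 1 ⊇ ⋯`
  let Mi : ℕ → {S : Set ℕ // S.Infinite} := fun l =>
    Nat.rec (motive := fun _ => {S : Set ℕ // S.Infinite})
      ⟨R 0 Set.univ Set.infinite_univ, hRinf 0 _ _⟩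
      (fun l Ml => ⟨R (l + 1) Ml.1 Ml.2, hRinf _ _ _⟩) l
  let M : ℕ → Set ℕ := fun l => (Mi l).1
  have hMinf : ∀ l, (M l).Infinite := fun l => (Mi l).2
  have hMsucc : ∀ l, M (l + 1) = R (l + 1) (M l) (hMinf l) := fun l => rfl
  have hM0 : M 0 = R 0 Set.univ Set.infinite_univ := rfl
  have hsub : ∀ l, M (l + 1) ⊆ M l := fun l => by rw [hMsucc]; exact hRsub _ _ _
  -- stability of `M l` for `P (· + l)`
  have hstP : ∀ l, ∀ M'' : Set ℕ, M'' ⊆ M l → M''.Infinite →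
      ⨅ m ∈ M'', P (m + l) = ⨅ m ∈ M l, P (m + l) := by
    intro l
    cases l with
    | zero => rw [hM0]; exact hRP 0 _ _
    | succ l => rw [hMsucc]; exact hRP _ _ _
  -- stability of `M (l + 1)` for `Q (· + l)` and constancy of the labels of the edges `· + l`
  have hstQ : ∀ l, ∀ M'' : Set ℕ, M'' ⊆ M (l + 1) → M''.Infinite →
      ⨅ m ∈ M'', Q (m + l) = ⨅ m ∈ M (l + 1), Q (m + l) := by
    intro l; rw [hMsucc]; exact hRQ _ _ _
  have hj : ∀ l, ∃ b, ∀ m ∈ M (l + 1), j (m + l) = b := by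
    intro l; rw [hMsucc]; exact hRj _ _ _
  have hG : ∀ l, ∃ c, ∀ m ∈ M (l + 1), G (m + l) = c := by
    intro l; rw [hMsucc]; exact hRG _ _ _
  choose j' hj' using hj
  choose c hc using hG
  refine ⟨fun l => ⨅ m ∈ M l, P (m + l), fun l => ⨅ m ∈ M (l + 1), Q (m + l), j',
    fun l => (c l : B), ?_, ?_, ?_, ?_, ?_, ?_, ?_⟩
  · -- vertex primes
    intro l
    show (⨅ m ∈ M l, P (m + l)).IsPrime
    exact isPrime_biInf_of_stable (fun m => P (m + l)) (hMinf l) (fun m _ => hP _) (hstP l)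
  · -- edge primes
    intro l
    show (⨅ m ∈ M (l + 1), Q (m + l)).IsPrime
    exact isPrime_biInf_of_stable (fun m => Q (m + l)) (hMinf (l + 1)) (fun m _ => hQ _) (hstQ l)
  · -- first projection dominant
    intro l f
    show ι₁ f ∈ ⨅ m ∈ M (l + 1), Q (m + l) ↔ f ∈ ⨅ m ∈ M l, P (m + l)
    rw [mem_biInf_iff, ← hstP l (M (l + 1)) (hsub l) (hMinf (l + 1)), mem_biInf_iff]
    exact forall₂_congr fun m _ => h1 (m + l) f
  · -- second projection dominant
    intro l f
    show ι₂ f ∈ ⨅ m ∈ M (l + 1), Q (m + l) ↔ f ∈ ⨅ m ∈ M (l + 1), P (m + (l + 1))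
    rw [mem_biInf_iff, mem_biInf_iff]
    exact forall₂_congr fun m _ => h2 (m + l) f
  · -- closed arena conditions
    intro l x hx
    show x ∈ ⨅ m ∈ M (l + 1), Q (m + l)
    rw [mem_biInf_iff]
    intro m hm
    apply h3 (m + l)
    rw [hj' l m hm]
    exact hx
  · -- open arena condition
    intro l
    obtain ⟨m₀, hm₀⟩ := (hMinf (l + 1)).nonempty
    have hcm : (c l : B) = g (m₀ + l) := by
      rw [← hc l m₀ hm₀]
    show (c l : B) ∈ Tneg (j' l) ∧ (c l : B) ∉ ⨅ m ∈ M (l + 1), Q (m + l)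
    constructor
    · rw [hcm, ← hj' l m₀ hm₀]
      exact (h4 (m₀ + l)).1
    · intro hmem
      apply (h4 (m₀ + l)).2
      rw [← hcm]
      exact (mem_biInf_iff.1 hmem) m₀ hm₀
  · -- strictness
    intro l
    show ∃ n, ⨅ m ∈ M l, P (m + l) < P n
    obtain ⟨m₁, hm₁, m₂, hm₂, hne⟩ := (hMinf l).nontrivial
    have hle : ∀ m ∈ M l, ⨅ m ∈ M l, P (m + l) ≤ P (m + l) := fun m hm => iInf₂_le m hm
    by_contra hcon
    push Not at hcon
    have heq : ∀ m ∈ M l, ⨅ m ∈ M l, P (m + l) = P (m + l) := fun m hm =>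
      (eq_or_lt_of_le (hle m hm)).resolve_right (hcon (m + l))
    have := hinj ((heq m₁ hm₁).symm.trans (heq m₂ hm₂))
    exact hne (Nat.add_right_cancel this)

end Summit.ResolutionOfSingularities.ResolutionOfSingularities.Theorems.FrobeniusClosing.ClosingArena
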